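import Mathlib
import Literature.MathematicalPhysics.QuantumFieldTheory.Balaban1983to89.B9Ineq347

/-!
# `Balaban1983to89.B9Thm34Inv` — "The inverse satisfies Theorem 3.2" (B9 p. 403): the (Q′G′²Q′*)⁻¹ part of the Sect. B step, kernel-checked

T. Bałaban, *Propagators for lattice gauge theories in a background field*, Commun. Math. Phys. **99**, 389–434
(1985) [Balaban1985BackgroundPropagators] (cell paper B9; PDF held `paper:balaban1985-cmp99-background-propagators`,
journal page = PDF page + 388).  Sibling of `…Balaban1983to89.B9` (UNTOUCHED: Theorem 3.2 = `B9.Thm32Printed` /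
`B9.Thm31and32Printed`, the Sect. B step = the by-reference leaf `B9.SectBStepPrinted` whose conclusion
`B9.Thms31to33IneqAt … (mul U′ U)` carries (3.48) at U′U with NEW constants (B₁′, δ₁′)), of `…B9Thm34Ext` (the
G′(U′U) part of the same step, whose transport `toB6 : B9.Geometry → B6.Geometry` is reused) and of `…B9Ineq347`
(whose typed scale transfer `ScaleTransfer` is reused), using the block-majorant calculus of [4] =
[Balaban1984PropagatorsII] typed by unit pv08 (`…B6RandomWalk`: `HasMajorant`, `hasMajorant_mul`, `Ineq261`,
`Triangle254`, `majorant_of_fixedPoint_266`).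

CITATION HEADER (lean-in-tree rule 2026-08-18).  This module is a KERNEL-CHECKED BOOKKEEPING STEP of the published
paper [Balaban1985BackgroundPropagators], p. 403 [PDF 15], verbatim (render
`…/1985-cmp99-background-propagators-p015-x2.png`):

> *"Let us consider the operator (Q′(U)G′²(U)Q′\*(U))⁻¹. Its inverse can be analytically continued to
> configurations U′U and has the expansion Q′(U′U)G′²(U′U)Q′\*(U′U) = Q′(U)G′²(U)Q′\*(U) + F′₂(A)G′²(U′U)Q′\*(U) +
> Q′(U)G′²(U′U)F′₂\*(A) + F′₂(A)G′²(U′U)F′₂\*(A) + Q′(U)G′(U′U)V′(A)G′²(U)Q′\*(U) + Q′(U)G′²(U)V′(A)G′(U′U)Q′\*(U) +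
> Q′(U)G′(U)V′(A)G′²(U′U)V′(A)G′(U)Q′\*(U) = Q′(U)G′²(U)Q′\*(U) + C′(A), (3.65) where the operator C′(A) is defined by
> the last equality. Using the results obtained for operators building it, and Lemma 2.1 [4], in the same way as in
> the bounds (2.68) in [4], we get |C′(A; y, y′)| ≦ O(1)α₁(L^jη)⁴(L^{j′}η)^{−d}e^{−(1/2)δ₀d(y,y′)} for y ∈ Λ_j,
> y′ ∈ Λ_{j′}. (3.66)  Using Theorem 3.2 and the above bound we obtain Q′(U′U)G′²(U′U)Q′\*(U′U) =
> (I + C′(A)(Q′(U)G′²(U)Q′\*(U))⁻¹)·Q′(U)G′²(U)Q′\*(U), |C′(A)(Q′(U)G′²(U)Q′\*(Q))⁻¹)(y, y′)| ≦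
> O(1)α₁(L^{j′}η)^{−d}e^{−(1/2)δ₀d(y,y′)}, (3.67) thus the operators in the equality are invertible and an inverse
> of the left-hand side can be expressed by a Neumann series convergent for α₁ sufficiently small. Each term of the
> series is an analytic function of A on the domain (3.37). The inverse satisfies Theorem 3.2."*

("Q′\*(Q)" in (3.67) is a misprint for Q′\*(U): the operator inverted is the one of the preceding display and of
Theorem 3.2; cell DIVERGENCE row D-b09.12), where Theorem 3.2 reads (p. 398 [PDF 10], verbatim) *"Under the assumptions
of Theorem 3.1, and with the same constants, the following inequality holds: |(Q′(U)G′²(U)Q′\*(U))⁻¹(y, y′)| ≦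
B₀(L^jη)^{−4}(L^{j′}η)^{−d}e^{−δ₀d(y,y′)}, y, y′ ∈ 𝔅 (y ∈ Λ_j, y′ ∈ Λ_{j′}) (3.48)"* (`B9.Thm32Printed`), and
"Lemma 2.1 [4]" = [Balaban1984PropagatorsII] p. 234 [PDF 12]: (2.60) (in the scale-transfer form of the p. 398 remark
*"Using Lemma 2.1 in [4] we may replace the factor (L^jη)^α by (L^jη)^β(L^{j′}η)^γ with β + γ = α"*, typed
`B9Ineq347.ScaleTransfer`), (2.61) *"sup_{y∈𝔅} Σ_{y′∈𝔅} e^{−αδ₀d(y,y′)} ≦ c₁(α)"* (typed `B6RandomWalk.Ineq261`,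
c₁(α) = 12c₀^d(½α) = `B6.c1 d δ₀ α`), together with the properties of the multiscale distance d of [4] (2.46)
p. 231 (an infimum of contour lengths over admissible contours with end-points y, y′, hence symmetric and satisfying
the triangle inequality (2.54) p. 233, with d(y, y) = 0, d ≧ 0) — all entering as HYPOTHESES on the abstract carrier.

THE TYPING.  The operators of the displays act on functions on the finite set 𝔅 = ⋃_j Λ_j (`g.Site`,
`[Fintype g.Site]`); they are typed as `Module.End ℝ (g.Site → ℝ)` (real scalar model of the 𝔤-valued block
functions, as everywhere in the cell's B9 typing: `B9.SiteKernel.ker : Cfg → Site → Site → ℝ`).  A KERNEL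
"T(y, y′), y ∈ Λ_j, y′ ∈ Λ_{j′}" is the kernel with respect to the scaled pairing Σ_{y′}(L^{j′}η)^d(·) on 𝔅:
(Tf)(y) = Σ_{y′∈𝔅}(L^{j′}η)^d T(y, y′)f(y′) (`ker (vol g d) T`, `apply_eq_sum_ker`) — this is the reading under which
the factor (L^{j′}η)^{−d} of (3.48), (3.66), (3.67) is the reciprocal pairing weight, so that a kernel bound
|T(y,y′)| ≦ K(y,y′)(L^{j′}η)^{−d} IS pv08's block-majorant statement `HasMajorant id T K` of [4] (2.51) for the trivial
block map 𝔅 → 𝔅 (`hasMajorant_id_iff`, `ker_le_iff`).  Nothing else is modelled: Q′, G′, F′₂, V′ do not occur —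
only L = Q′(U)G′²(U)Q′\*(U), its inverse Cinv (the kernel of Theorem 3.2), L′ = Q′(U′U)G′²(U′U)Q′\*(U′U) and
C′(A) = L′ − L *"defined by the last equality"* (hypothesis `h365`).

WHAT IS REPRODUCED (0 sorry), for ONE geometry and one pair of configurations, every analytic input a hypothesis of
the printed shape:
* `factor_367` — the first line of (3.67): L′ = (I + C′(A)·Cinv)·L, from (3.65) and Cinv·L = I (pure algebra).
* `ineq367_of_366_348` — **(3.66) + (3.48) + Lemma 2.1 ⇒ the second line of (3.67)**, constants explicit: if C′(A)
  has the (3.66)-majorant κα₁(L^jη)⁴e^{−½δ₀d(y,y′)} (κ = the printed O(1)) and Cinv the (3.48)-majorant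
  B₀(L^jη)^{−4}e^{−δ₀d(y,y′)} (pairing form, (L^{j′}η)^{−d} absorbed), then E = C′(A)·Cinv has the majorant
  θ·e^{−(½−α)δ₀d(y,y′)} with **θ = κB₀Cc₁(½+α)·α₁** = "O(1)α₁" — the y″-sum of the composed kernels costs: the scale
  transfer e^{−αδ₀d(y,y″)}(L^jη)⁴(L^{j″}η)^{−4} ≦ C (= `ScaleTransfer` at exponent α for the weight (L^jη)^{−4}; C = L⁴
  under L⁴e^{−αδ₀RM} ≦ 1 by `B9Ineq347.scaleTransfer_of_260`), the triangle inequality and the symmetry of d, and (2.61)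
  at the exponent ½ + α.  LOCATED: the printed rate ½δ₀ of (3.67) is obtained as (½ − α)δ₀ for an arbitrary
  0 < α < ½ (the fraction αδ₀ pays for the scale transfer (L^jη)⁴(L^{j″}η)^{−4} between the two factors) — one more
  instance of the paper's standing convention *"of course with different constants, although changes are small"*
  (p. 403 l. 4–5), cell GAPS row G-B9-21; no claim of the paper depends on the exact value ½δ₀.
* `isUnit_one_add_of_rowSum`, `rowSum_le_of_majorant`, `isUnit_ext` — *"thus the operators in the equality are
  invertible"*: a majorant θe^{−rd} with θc₁ < 1 bounds the row sums of |E(y,y′)(L^{j′}η)^d| by θc₁ < 1, so I + E is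
  injective on the finite-dimensional space of functions on 𝔅, hence invertible; L is invertible (Cinv); so is
  L′ = (I + E)L.
* `fixedPoint_of_inverse`, `inv_eq_neumann_partialSum` — *"an inverse of the left-hand side can be expressed by a
  Neumann series"*: the inverse T of L′ satisfies T = Cinv − T·E, i.e. T = Σ_{n<N}Cinv(−E)ⁿ + T(−E)^N for every N
  (pv08's `fixedPoint_telescope`), the partial sums of the Neumann series Cinv·Σ_n(−C′(A)Cinv)ⁿ.
* `inv_majorant_of_367` — *"convergent for α₁ sufficiently small … The inverse satisfies Theorem 3.2"* with the
  constants NAMED: under θc₁(r, α′) < 1 (r = (½−α)δ₀; Lemma 2.1 used at the rate r with exponent α′) the inverse T has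
  the majorant B₀c₁(r,α′)(1 − θc₁(r,α′))⁻¹(L^jη)^{−4}e^{−(1−α′)r·d(y,y′)} — pv08's `majorant_of_fixedPoint_266` ([4]
  (2.66)) read through `toB6` with G′₀ = Cinv, R = −E.
* `inverse_satisfies_thm32` — everything chained in the PRINTED kernel notation: from (3.48) for Cinv = L⁻¹ (as printed,
  with (L^{j′}η)^{−d}), (3.65) L′ = L + C′(A), (3.66) for C′(A) (as printed), Lemma 2.1 at the two exponent/rate pairs,
  the scale transfer, and the EXPLICIT threshold α₁ ≦ a₁ := (2κB₀Cc₁(δ₀,½+α)c₁(r,α′))⁻¹ (so θc₁(r,α′) ≦ ½): L′ has a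
  two-sided inverse T with |T(y,y′)| ≦ 2B₀c₁(r,α′)(L^jη)^{−4}(L^{j′}η)^{−d}e^{−(1−α′)(½−α)δ₀d(y,y′)} — i.e. (3.48) at
  U′U with **B₁′ = 2B₀c₁((½−α)δ₀, α′)** and **δ₁′ = (1−α′)(½−α)δ₀**, the (B₁′, δ₁′) of `B9.SectBStepPrinted`'s
  conclusion, and Theorem 3.4's a₁ witnessed on this operator (a₁ depends on d, L only: via κ, B₀, δ₀, C = L⁴, c₁).

WHAT IS NOT REPRODUCED: (i) (3.66) itself — *"in the same way as in the bounds (2.68) in [4]"* from the bounds for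
F′₂, V′ ((3.54)–(3.61)), Theorem 3.1 for G′(U′U) and Lemma 2.1 — a by-reference, asserted-routine step kept as the
NAMED HYPOTHESIS `h366` of the printed shape (cell GAPS G-B9-02 narrowed; hostile prose re-derivation is referee seat
adv8's ADV-H pass 3); (ii) *"Each term of the series is an analytic function of A on the domain (3.37)"* and the
analyticity clause of Theorem 3.4 (`B9.Thm34Printed`'s abstract `IsAnalyticExt`) — outside this real majorant
typing; (iii) the identification of the abstract `B9.SiteKernel` value `Cinv.ker (mul U′ U)` with the kernel
`ker (vol g d) T` of the operator inverse constructed here (the `Loc`/`SiteKernel` carriers of `…B9` are not tied to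
functions 𝔅 → ℝ; the dictionary is this docstring, as for `…B9Thm34Ext`, `…B9Ineq347`); (iv) (2.60)/(2.61) of [4]
and the properties of d for THIS geometry (hypotheses); (v) P(U′U), (3.68) and the rest of Sect. B.
NOTHING of the series' end-statement is asserted; value = kernel-checked bookkeeping of a printed "thus … can be
expressed by a Neumann series … satisfies Theorem 3.2" with its constants and size condition made explicit, NOT
summit progress.  Unit `b2b-balaban-b09-g3` (paper sub-cell B09, gen 3), SHARPEN pass 3 of node T06.4 (Thm 3.2 part
of the Sect. B step); cell rows C-B9-19, G-B9-21, D-b09.12.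
-/

namespace Literature.MathematicalPhysics.QuantumFieldTheory.Balaban1983to89.B9Thm34Inv

open Literature.MathematicalPhysics.QuantumFieldTheory.Balaban1983to89

/-! ## Kernels of linear operators on the functions on a finite set -/

section Entries

variable {S : Type} [DecidableEq S]

/-- The matrix entry T(δ_{y′})(y) of a linear operator on the functions on the finite set S (𝔅): the kernel of T
with respect to the counting pairing. [folklore] -/
def entry (T : Module.End ℝ (S → ℝ)) (y y' : S) : ℝ :=
  T (Pi.single y' 1) y

/-- The kernel T(y, y′) of T with respect to the weighted pairing Σ_{y′} w(y′)(·) (for 𝔅: w(y′) = (L^{j′}η)^d,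
`vol`), so that (Tf)(y) = Σ_{y′} w(y′)T(y, y′)f(y′) (`apply_eq_sum_ker`) — the reading of the kernels
"(y, y′), y ∈ Λ_j, y′ ∈ Λ_{j′}" of (3.48), (3.66), (3.67). [cite: Balaban1985BackgroundPropagators, (3.48) p.398] -/
noncomputable def ker (w : S → ℝ) (T : Module.End ℝ (S → ℝ)) (y y' : S) : ℝ :=
  entry T y y' / w y'

/-- Entries of −T. [folklore] -/
theorem entry_neg (T : Module.End ℝ (S → ℝ)) (y y' : S) : entry (-T) y y' = -entry T y y' := by
  simp [entry]

/-- A kernel bound with the reciprocal pairing weight, |T(y,y′)| ≦ A·w(y′)⁻¹ (for 𝔅: A·(L^{j′}η)^{−d}), IS the entry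
bound |T(δ_{y′})(y)| ≦ A. [folklore] -/
theorem ker_le_iff (w : S → ℝ) {y' : S} (hw : 0 < w y') (T : Module.End ℝ (S → ℝ)) (y : S) (A : ℝ) :
    |ker w T y y'| ≤ A * (w y')⁻¹ ↔ |entry T y y'| ≤ A := by
  rw [ker, abs_div, abs_of_pos hw, div_le_iff₀ hw, inv_mul_cancel_right₀ hw.ne']

variable [Fintype S]

/-- Expansion of a function in point masses. [folklore] -/
theorem pi_eq_sum_single (f : S → ℝ) : f = ∑ y' : S, f y' • (Pi.single y' (1 : ℝ) : S → ℝ) := by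
  funext z
  rw [Finset.sum_apply]
  simp [Pi.single_apply]

/-- (Tf)(y) = Σ_{y′} T(δ_{y′})(y) f(y′). [folklore] -/
theorem apply_eq_sum_entry (T : Module.End ℝ (S → ℝ)) (f : S → ℝ) (y : S) :
    T f y = ∑ y' : S, entry T y y' * f y' := by
  conv_lhs => rw [pi_eq_sum_single f, map_sum, Finset.sum_apply]
  refine Finset.sum_congr rfl fun y' _ => ?_
  rw [map_smul, Pi.smul_apply, smul_eq_mul, entry, mul_comm]

/-- (Tf)(y) = Σ_{y′} w(y′) T(y, y′) f(y′): `ker w T` IS the kernel of T with respect to the weighted pairing.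
[cite: Balaban1985BackgroundPropagators, (3.48) p.398] -/
theorem apply_eq_sum_ker (w : S → ℝ) (hw : ∀ y, w y ≠ 0) (T : Module.End ℝ (S → ℝ)) (f : S → ℝ) (y : S) :
    T f y = ∑ y' : S, w y' * ker w T y y' * f y' := by
  rw [apply_eq_sum_entry]
  refine Finset.sum_congr rfl fun y' _ => ?_
  rw [ker, mul_div_cancel₀ _ (hw y')]

/-- Entries of a product: matrix multiplication. [folklore] -/
theorem entry_mul (A B : Module.End ℝ (S → ℝ)) (y y' : S) :
    entry (A * B) y y' = ∑ y'' : S, entry A y y'' * entry B y'' y' := by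
  rw [entry, Module.End.mul_apply, apply_eq_sum_entry]
  rfl

/-- *"thus the operators in the equality are invertible"* (p. 403), the mechanism: if the row sums Σ_{y′}|E(δ_{y′})(y)|
are bounded by q < 1 then I + E is injective (maximum principle for the sup norm on the finite set), hence — the
space of functions on a finite set being finite-dimensional — invertible. [cite: Balaban1985BackgroundPropagators, (3.67) p.403] -/
theorem isUnit_one_add_of_rowSum (E : Module.End ℝ (S → ℝ)) (q : ℝ) (hq : q < 1)
    (hE : ∀ y : S, ∑ y' : S, |entry E y y'| ≤ q) : IsUnit (1 + E) := by
  rw [LinearMap.isUnit_iff_ker_eq_bot, LinearMap.ker_eq_bot]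
  refine (injective_iff_map_eq_zero _).mpr fun f hf => ?_
  have hf' : ∀ y, f y = -(E f y) := fun y => by
    have := congrFun hf y
    simp only [LinearMap.add_apply, Module.End.one_apply, Pi.add_apply, Pi.zero_apply] at this
    linarith
  rcases isEmpty_or_nonempty S with hS | hS
  · exact funext fun y => (IsEmpty.false y).elim
  obtain ⟨y₀, -, hy₀⟩ := Finset.exists_max_image Finset.univ (fun y => |f y|) Finset.univ_nonempty
  have hm : ∀ y, |f y| ≤ |f y₀| := fun y => hy₀ y (Finset.mem_univ y)
  have key : |f y₀| ≤ q * |f y₀| := by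
    calc |f y₀| = |E f y₀| := by rw [hf' y₀, abs_neg]
      _ = |∑ y', entry E y₀ y' * f y'| := by rw [apply_eq_sum_entry]
      _ ≤ ∑ y', |entry E y₀ y' * f y'| := Finset.abs_sum_le_sum_abs _ _
      _ = ∑ y', |entry E y₀ y'| * |f y'| := Finset.sum_congr rfl fun _ _ => abs_mul _ _
      _ ≤ ∑ y', |entry E y₀ y'| * |f y₀| :=
          Finset.sum_le_sum fun y' _ => mul_le_mul_of_nonneg_left (hm y') (abs_nonneg _)
      _ = (∑ y', |entry E y₀ y'|) * |f y₀| := by rw [Finset.sum_mul]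
      _ ≤ q * |f y₀| := mul_le_mul_of_nonneg_right (hE y₀) (abs_nonneg _)
  have h0 : |f y₀| ≤ 0 := by nlinarith [key, abs_nonneg (f y₀), hq]
  funext y
  exact abs_nonpos_iff.mp ((hm y).trans h0)

end Entries

section Algebra

/-! ## (3.65) ⇒ the first line of (3.67); the fixed-point form of the Neumann series -/

/-- **(3.67), first line**: *"Q′(U′U)G′²(U′U)Q′\*(U′U) = (I + C′(A)(Q′(U)G′²(U)Q′\*(U))⁻¹)·Q′(U)G′²(U)Q′\*(U)"* —
from (3.65) L′ = L + C′(A) and Cinv·L = I: L′ = (I + C′(A)Cinv)L. [cite: Balaban1985BackgroundPropagators, (3.65)–(3.67) p.403] -/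
theorem factor_367 {V : Type} [AddCommGroup V] [Module ℝ V] {L L' Linv Cp : Module.End ℝ V}
    (hLinv : Linv * L = 1) (h365 : L' = L + Cp) : L' = (1 + Cp * Linv) * L := by
  rw [add_mul, one_mul, mul_assoc, hLinv, mul_one, h365]

/-- The Neumann series as a fixed point: if T is a left inverse of L′ = L + C′(A) and Cinv a right inverse of L, then
T = Cinv − T·(C′(A)Cinv) — i.e. T = Cinv·(I + C′(A)Cinv)⁻¹ = Cinv Σ_n(−C′(A)Cinv)ⁿ formally.
[cite: Balaban1985BackgroundPropagators, (3.67) p.403] -/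
theorem fixedPoint_of_inverse {V : Type} [AddCommGroup V] [Module ℝ V] {L L' Linv Cp T : Module.End ℝ V}
    (hL : L * Linv = 1) (h365 : L' = L + Cp) (hT : T * L' = 1) : T = Linv - T * (Cp * Linv) := by
  have hTL : T * L = 1 - T * Cp := by
    refine eq_sub_of_add_eq ?_
    rw [← mul_add, ← h365]
    exact hT
  calc T = T * (L * Linv) := by rw [hL, mul_one]
    _ = (T * L) * Linv := (mul_assoc _ _ _).symm
    _ = (1 - T * Cp) * Linv := by rw [hTL]
    _ = Linv - T * (Cp * Linv) := by rw [sub_mul, one_mul, mul_assoc]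

/-- *"an inverse of the left-hand side can be expressed by a Neumann series"*: the fixed point T = Cinv − T·E
telescopes into the partial sums of the Neumann series, T = Σ_{n<N}Cinv(−E)ⁿ + T(−E)^N for every N (pv08's
`fixedPoint_telescope`; the remainder is what the majorant bound kills as N → ∞).
[cite: Balaban1985BackgroundPropagators, (3.67) p.403] -/
theorem inv_eq_neumann_partialSum {V : Type} {Linv E T : Module.End ℝ (V → ℝ)} (hfix : T = Linv - T * E)
    (N : ℕ) : T = (∑ n ∈ Finset.range N, Linv * (-E) ^ n) + T * (-E) ^ N :=
  B6RandomWalk.fixedPoint_telescope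
    (hfix.trans ((sub_eq_add_neg Linv (T * E)).trans (congrArg (fun Z => Linv + Z) (mul_neg T E).symm))) N

end Algebra

/-! ## The dictionary with the block majorants of [4] (2.51): blocks = points of 𝔅 -/

section Majorants

variable {g : B9.Geometry} [Fintype g.Site] [DecidableEq g.Site] {R : ℝ} {H : Prop}

/-- For operators on the functions on 𝔅 itself (block map = identity), pv08's `HasMajorant` of [4] (2.51) —
*"|(Tλ)(x)| ≦ K(y, y′)|λ|, x ∈ B^j(y), supp λ ⊂ B^{j′}(y′)"* — IS the entrywise bound |T(δ_{y′})(y)| ≦ K(y, y′).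
[cite: Balaban1984PropagatorsII, (2.51) p.232] -/
theorem hasMajorant_id_iff (T : Module.End ℝ (g.Site → ℝ)) (K : g.Site → g.Site → ℝ) :
    B6RandomWalk.HasMajorant (g := B9Thm34Ext.toB6 g R H) (fun x : g.Site => x) T K ↔
      ∀ y y' : g.Site, |entry T y y'| ≤ K y y' := by
  constructor
  · intro h y y'
    have hs : B6RandomWalk.BlockSupp (g := B9Thm34Ext.toB6 g R H) (fun x : g.Site => x) (Pi.single y' (1 : ℝ)) y' 1 :=
      ⟨zero_le_one, fun x (hx : x = y') => by rw [hx]; simp, fun x (hx : x ≠ y') => by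
        simp [Pi.single_eq_of_ne hx]⟩
    simpa [entry] using h y' _ 1 hs y
  · intro h y' μ B hμ x
    have hx : T μ x = entry T x y' * μ y' := by
      rw [apply_eq_sum_entry]
      exact Finset.sum_eq_single y' (fun y'' _ hne => by rw [hμ.off y'' hne, mul_zero])
        (fun hy => absurd (Finset.mem_univ _) hy)
    rw [hx, abs_mul]
    exact mul_le_mul (h x y') (hμ.bound y' rfl) (abs_nonneg _) ((abs_nonneg _).trans (h x y'))

/-- Row sums from a majorant θe^{−r·d(y,y′)} and (2.61) of [4] at the rate r, exponent α′ ≦ 1: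
Σ_{y′}|E(δ_{y′})(y)| ≦ θc₁(r, α′). [cite: Balaban1984PropagatorsII, (2.61) p.234] -/
theorem rowSum_le_of_majorant (d : ℕ) (r α' θ : ℝ) (hθ : 0 ≤ θ) (hα' : α' ≤ 1)
    (hr : 0 ≤ r) (hdnn : ∀ a b : g.Site, 0 ≤ g.dist a b) (h261 : B6RandomWalk.Ineq261 d (B9Thm34Ext.toB6 g R H) r α')
    {E : Module.End ℝ (g.Site → ℝ)}
    (hE : B6RandomWalk.HasMajorant (g := B9Thm34Ext.toB6 g R H) (fun x : g.Site => x) E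
      (fun a b => θ * Real.exp (-(r * g.dist a b)))) :
    ∀ y : g.Site, ∑ y' : g.Site, |entry E y y'| ≤ θ * B6.c1 d r α' := by
  intro y
  have h := (hasMajorant_id_iff (R := R) (H := H) _ _).mp hE
  calc ∑ y' : g.Site, |entry E y y'| ≤ ∑ y' : g.Site, θ * Real.exp (-(α' * r * g.dist y y')) := by
        refine Finset.sum_le_sum fun y' _ => (h y y').trans (mul_le_mul_of_nonneg_left ?_ hθ)
        refine Real.exp_le_exp.mpr ?_
        have := mul_nonneg (mul_nonneg (sub_nonneg.mpr hα') hr) (hdnn y y')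
        nlinarith
    _ = θ * ∑ y' : g.Site, Real.exp (-(α' * r * g.dist y y')) := by rw [Finset.mul_sum]
    _ ≤ θ * B6.c1 d r α' := mul_le_mul_of_nonneg_left (h261 y) hθ

/-! ## (3.66) + (3.48) + Lemma 2.1 ⇒ (3.67) -/

omit [DecidableEq g.Site] in
/-- **(3.67), second line, with its O(1) explicit**: *"Using Theorem 3.2 and the above bound we obtain …
|C′(A)(Q′(U)G′²(U)Q′\*(U))⁻¹(y, y′)| ≦ O(1)α₁(L^{j′}η)^{−d}e^{−(1/2)δ₀d(y,y′)}"*.  Hypotheses (pairing form, the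
factor (L^{j′}η)^{−d} absorbed into the pairing weight; P(y) = (L^jη)^{−4}, any P > 0): `h366` = (3.66) for C′(A)
with its O(1) =: κ; `h348` = (3.48) for Cinv; `hST` = the scale transfer e^{−αδ₀d(y,y″)}P(y″) ≦ C·P(y) of the p. 398
remark ([4] (2.60); C = L⁴ for P = (L^jη)^{−4}); `h261` = (2.61) of [4] at the exponent ½ + α; the triangle inequality
(2.54) and the symmetry of d.  Conclusion: E = C′(A)·Cinv has the majorant θe^{−(½−α)δ₀d(y,y′)} with
θ = κB₀Cc₁(½+α)·α₁ ("O(1)α₁").  Route, term by term in the y″-sum of the composed kernels ([4] (2.52)):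
e^{−½δ₀d(y,y″)} = e^{−αδ₀d(y,y″)}e^{−(½−α)δ₀d(y,y″)}, the first factor carries (L^jη)⁴(L^{j″}η)^{−4} (scale transfer),
(½−α)δ₀d(y,y″) + δ₀d(y″,y′) ≧ (½−α)δ₀d(y,y′) + (½+α)δ₀d(y′,y″) (triangle inequality, symmetry), and the y″-sum of
e^{−(½+α)δ₀d(y′,y″)} is (2.61).  LOCATED (cell GAPS G-B9-21): the rate comes out as (½−α)δ₀, 0 < α < ½ arbitrary,
not ½δ₀. [cite: Balaban1985BackgroundPropagators, (3.66)–(3.67) p.403; Balaban1984PropagatorsII, Lemma 2.1 p.234] -/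
theorem ineq367_of_366_348 (d : ℕ) (δ₀ α κ B₀ C α₁ : ℝ) (P : g.Site → ℝ)
    (hκ : 0 ≤ κ) (hα₁ : 0 ≤ α₁) (hB₀ : 0 ≤ B₀) (hC : 0 ≤ C) (hP : ∀ y, 0 < P y) (hα : α ≤ 1 / 2) (hδ₀ : 0 ≤ δ₀)
    (htri : B6RandomWalk.Triangle254 (B9Thm34Ext.toB6 g R H)) (hsymm : ∀ a b : g.Site, g.dist a b = g.dist b a)
    (hST : B9Ineq347.ScaleTransfer g δ₀ α C P)
    (h261 : B6RandomWalk.Ineq261 d (B9Thm34Ext.toB6 g R H) δ₀ (1 / 2 + α))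
    {Cp Linv : Module.End ℝ (g.Site → ℝ)}
    (h366 : B6RandomWalk.HasMajorant (g := B9Thm34Ext.toB6 g R H) (fun x : g.Site => x) Cp
      (fun a b => κ * α₁ * (P a)⁻¹ * Real.exp (-(δ₀ / 2 * g.dist a b))))
    (h348 : B6RandomWalk.HasMajorant (g := B9Thm34Ext.toB6 g R H) (fun x : g.Site => x) Linv
      (fun a b => B₀ * P a * Real.exp (-(δ₀ * g.dist a b)))) :
    B6RandomWalk.HasMajorant (g := B9Thm34Ext.toB6 g R H) (fun x : g.Site => x) (Cp * Linv)
      (fun a b => κ * α₁ * B₀ * C * B6.c1 d δ₀ (1 / 2 + α) * Real.exp (-((1 / 2 - α) * δ₀ * g.dist a b))) := by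
  have hK₂ : ∀ a b : g.Site, 0 ≤ B₀ * P a * Real.exp (-(δ₀ * g.dist a b)) := fun a b =>
    mul_nonneg (mul_nonneg hB₀ (hP a).le) (Real.exp_nonneg _)
  refine B6RandomWalk.hasMajorant_mono (g := B9Thm34Ext.toB6 g R H) _
    (B6RandomWalk.hasMajorant_mul (g := B9Thm34Ext.toB6 g R H) _ h366 h348 hK₂) fun a b => ?_
  have hcoef : 0 ≤ (1 / 2 - α) * δ₀ := mul_nonneg (by linarith) hδ₀
  have hterm : ∀ y'' : g.Site,
      κ * α₁ * (P a)⁻¹ * Real.exp (-(δ₀ / 2 * g.dist a y'')) * (B₀ * P y'' * Real.exp (-(δ₀ * g.dist y'' b))) ≤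
        κ * α₁ * B₀ * C * Real.exp (-((1 / 2 - α) * δ₀ * g.dist a b)) *
          Real.exp (-((1 / 2 + α) * δ₀ * g.dist b y'')) := by
    intro y''
    -- (i) the scale transfer (L^jη)⁴ e^{−αδ₀d(y,y″)} (L^{j″}η)^{−4} ≦ C
    have hst : (P a)⁻¹ * (Real.exp (-(α * δ₀ * g.dist a y'')) * P y'') ≤ C := by
      have h1 := hST a y''
      calc (P a)⁻¹ * (Real.exp (-(α * δ₀ * g.dist a y'')) * P y'') ≤ (P a)⁻¹ * (C * P a) :=
            mul_le_mul_of_nonneg_left h1 (inv_nonneg.mpr (hP a).le)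
        _ = C := by rw [mul_comm C, ← mul_assoc, inv_mul_cancel₀ (hP a).ne', one_mul]
    -- (ii) the splitting of the exponential
    have hsplit : Real.exp (-(δ₀ / 2 * g.dist a y'')) =
        Real.exp (-(α * δ₀ * g.dist a y'')) * Real.exp (-((1 / 2 - α) * δ₀ * g.dist a y'')) := by
      rw [← Real.exp_add]
      congr 1
      ring
    -- (iii) the triangle inequality (2.54) and the symmetry of d
    have htri' : Real.exp (-((1 / 2 - α) * δ₀ * g.dist a y'')) * Real.exp (-(δ₀ * g.dist y'' b)) ≤
        Real.exp (-((1 / 2 - α) * δ₀ * g.dist a b)) * Real.exp (-((1 / 2 + α) * δ₀ * g.dist b y'')) := by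
      rw [← Real.exp_add, ← Real.exp_add]
      refine Real.exp_le_exp.mpr ?_
      have h0 : g.dist a b ≤ g.dist a y'' + g.dist y'' b := htri a y'' b
      have h1 := mul_le_mul_of_nonneg_left h0 hcoef
      rw [hsymm b y'']
      linarith
    have hE : 0 ≤ Real.exp (-((1 / 2 - α) * δ₀ * g.dist a y'')) * Real.exp (-(δ₀ * g.dist y'' b)) :=
      mul_nonneg (Real.exp_nonneg _) (Real.exp_nonneg _)
    calc κ * α₁ * (P a)⁻¹ * Real.exp (-(δ₀ / 2 * g.dist a y'')) * (B₀ * P y'' * Real.exp (-(δ₀ * g.dist y'' b)))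
        = κ * α₁ * B₀ * ((P a)⁻¹ * (Real.exp (-(α * δ₀ * g.dist a y'')) * P y'')) *
            (Real.exp (-((1 / 2 - α) * δ₀ * g.dist a y'')) * Real.exp (-(δ₀ * g.dist y'' b))) := by
          rw [hsplit]; ring
      _ ≤ κ * α₁ * B₀ * C *
            (Real.exp (-((1 / 2 - α) * δ₀ * g.dist a b)) * Real.exp (-((1 / 2 + α) * δ₀ * g.dist b y''))) := by
          have hkab : 0 ≤ κ * α₁ * B₀ := mul_nonneg (mul_nonneg hκ hα₁) hB₀
          exact mul_le_mul (mul_le_mul_of_nonneg_left hst hkab) htri' hE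
            (mul_nonneg hkab hC)
      _ = _ := by ring
  have hpref : 0 ≤ κ * α₁ * B₀ * C * Real.exp (-((1 / 2 - α) * δ₀ * g.dist a b)) :=
    mul_nonneg (mul_nonneg (mul_nonneg (mul_nonneg hκ hα₁) hB₀) hC) (Real.exp_nonneg _)
  calc ∑ y'' : g.Site, κ * α₁ * (P a)⁻¹ * Real.exp (-(δ₀ / 2 * g.dist a y'')) *
          (B₀ * P y'' * Real.exp (-(δ₀ * g.dist y'' b)))
      ≤ ∑ y'' : g.Site, κ * α₁ * B₀ * C * Real.exp (-((1 / 2 - α) * δ₀ * g.dist a b)) *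
          Real.exp (-((1 / 2 + α) * δ₀ * g.dist b y'')) := Finset.sum_le_sum fun y'' _ => hterm y''
    _ = κ * α₁ * B₀ * C * Real.exp (-((1 / 2 - α) * δ₀ * g.dist a b)) *
          ∑ y'' : g.Site, Real.exp (-((1 / 2 + α) * δ₀ * g.dist b y'')) := by rw [Finset.mul_sum]
    _ ≤ κ * α₁ * B₀ * C * Real.exp (-((1 / 2 - α) * δ₀ * g.dist a b)) * B6.c1 d δ₀ (1 / 2 + α) :=
        mul_le_mul_of_nonneg_left (h261 b) hpref
    _ = κ * α₁ * B₀ * C * B6.c1 d δ₀ (1 / 2 + α) * Real.exp (-((1 / 2 - α) * δ₀ * g.dist a b)) := by ring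

/-! ## (3.67) ⇒ "the inverse satisfies Theorem 3.2", constants named -/

/-- *"thus the operators in the equality are invertible"*: with E = C′(A)Cinv of majorant θe^{−r·d} (r ≧ 0), (2.61)
of [4] at (r, α′), α′ ≦ 1, the smallness θc₁(r, α′) < 1, L′ = L + C′(A) and Cinv a two-sided inverse of L, the
operator L′ = Q′(U′U)G′²(U′U)Q′\*(U′U) is invertible. [cite: Balaban1985BackgroundPropagators, (3.67) p.403] -/
theorem isUnit_ext (d : ℕ) (r α' θ : ℝ) (hθ : 0 ≤ θ) (hα' : α' ≤ 1) (hr : 0 ≤ r)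
    (hdnn : ∀ a b : g.Site, 0 ≤ g.dist a b) (h261 : B6RandomWalk.Ineq261 d (B9Thm34Ext.toB6 g R H) r α')
    (hsmall : θ * B6.c1 d r α' < 1)
    {L L' Linv Cp : Module.End ℝ (g.Site → ℝ)} (hL : L * Linv = 1) (hLinv : Linv * L = 1) (h365 : L' = L + Cp)
    (h367 : B6RandomWalk.HasMajorant (g := B9Thm34Ext.toB6 g R H) (fun x : g.Site => x) (Cp * Linv)
      (fun a b => θ * Real.exp (-(r * g.dist a b)))) :
    IsUnit L' := by
  have h1 : IsUnit (1 + Cp * Linv) :=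
    isUnit_one_add_of_rowSum _ _ hsmall (rowSum_le_of_majorant (R := R) (H := H) d r α' θ hθ hα' hr hdnn h261 h367)
  have h2 : IsUnit L := ⟨⟨L, Linv, hL, hLinv⟩, rfl⟩
  rw [factor_367 hLinv h365]
  exact h1.mul h2

/-- **"The inverse satisfies Theorem 3.2", with the constants named** (pairing form).  If the inverse T of L′
satisfies the fixed-point equation T = Cinv − T·E of the Neumann series, Cinv has the (3.48)-majorant
B₀P(y)e^{−r·d(y,y′)} (rate weakened to r) and E the (3.67)-majorant θe^{−r·d(y,y′)}, Lemma 2.1 of [4] holds at the rate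
r with exponent α′ and θc₁(r, α′) < 1 (*"convergent for α₁ sufficiently small"*), then T has the majorant
B₀c₁(r,α′)(1 − θc₁(r,α′))⁻¹P(y)e^{−(1−α′)r·d(y,y′)} — [4] (2.66), pv08's `majorant_of_fixedPoint_266` with G′₀ = Cinv,
R = −E, read through `toB6`. [cite: Balaban1985BackgroundPropagators, (3.67) p.403; Balaban1984PropagatorsII, (2.66) p.234] -/
theorem inv_majorant_of_367 (d : ℕ) (r α' θ B₀ : ℝ) (P : g.Site → ℝ)
    (hB₀ : 0 ≤ B₀) (hP : ∀ y, 0 ≤ P y) (hθ : 0 ≤ θ) (hr : 0 ≤ r) (hα' : α' ≤ 1)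
    (htri : B6RandomWalk.Triangle254 (B9Thm34Ext.toB6 g R H)) (hrefl : ∀ y : g.Site, g.dist y y = 0)
    (hdnn : ∀ a b : g.Site, 0 ≤ g.dist a b) (h261 : B6RandomWalk.Ineq261 d (B9Thm34Ext.toB6 g R H) r α')
    (hsmall : θ * B6.c1 d r α' < 1)
    {T Linv E : Module.End ℝ (g.Site → ℝ)}
    (h348 : B6RandomWalk.HasMajorant (g := B9Thm34Ext.toB6 g R H) (fun x : g.Site => x) Linv
      (fun a b => B₀ * P a * Real.exp (-(r * g.dist a b))))
    (h367 : B6RandomWalk.HasMajorant (g := B9Thm34Ext.toB6 g R H) (fun x : g.Site => x) E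
      (fun a b => θ * Real.exp (-(r * g.dist a b))))
    (hfix : T = Linv - T * E) :
    B6RandomWalk.HasMajorant (g := B9Thm34Ext.toB6 g R H) (fun x : g.Site => x) T
      (fun a b => B₀ * B6.c1 d r α' * (1 - θ * B6.c1 d r α')⁻¹ * P a *
        Real.exp (-((1 - α') * r * g.dist a b))) := by
  have hαδ : 0 ≤ (1 - α') * r := mul_nonneg (sub_nonneg.mpr hα') hr
  have h263 := B9Thm34Ext.h263_of_h261 g R H d r α' htri hr hα' h261
  have hneg : B6RandomWalk.HasMajorant (g := B9Thm34Ext.toB6 g R H) (fun x : g.Site => x) (-E)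
      (fun a b => θ * Real.exp (-(r * g.dist a b))) := by
    rw [hasMajorant_id_iff] at h367 ⊢
    intro y y'
    rw [entry_neg, abs_neg]
    exact h367 y y'
  have hfix' : T = Linv + T * (-E) :=
    hfix.trans ((sub_eq_add_neg Linv (T * E)).trans (congrArg (fun Z => Linv + Z) (mul_neg T E).symm))
  exact B6RandomWalk.majorant_of_fixedPoint_266 (g := B9Thm34Ext.toB6 g R H) (fun x : g.Site => x) d r α' θ B₀ P hB₀ hP hθ
    hαδ htri hrefl hdnn h261 h263 hsmall h348 hneg hfix'

/-! ## Everything chained, in the printed kernel notation -/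

/-- The pairing weight (L^{j′}η)^d of the kernels on 𝔅 (its reciprocal is the factor (L^{j′}η)^{−d} of (3.48),
(3.66)–(3.68)). [cite: Balaban1985BackgroundPropagators, (3.48) p.398] -/
noncomputable def vol (g : B9.Geometry) (d : ℕ) (y : g.Site) : ℝ :=
  g.len y ^ (d : ℝ)

omit [Fintype g.Site] [DecidableEq g.Site] in
/-- (L^{j′}η)^d > 0 when L^{j′}η > 0. [folklore] -/
theorem vol_pos (d : ℕ) (hlen : ∀ y : g.Site, 0 < g.len y) (y : g.Site) : 0 < vol g d y :=
  Real.rpow_pos_of_pos (hlen y) _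

omit [Fintype g.Site] [DecidableEq g.Site] in
/-- ((L^{j′}η)^d)⁻¹ = (L^{j′}η)^{−d}. [folklore] -/
theorem vol_inv (d : ℕ) (hlen : ∀ y : g.Site, 0 < g.len y) (y : g.Site) :
    (vol g d y)⁻¹ = g.len y ^ (-(d : ℝ)) := by
  rw [vol, Real.rpow_neg (hlen y).le]

/-- **B9 p. 403: "thus the operators in the equality are invertible and an inverse of the left-hand side can be
expressed by a Neumann series convergent for α₁ sufficiently small. … The inverse satisfies Theorem 3.2" — with the
threshold and the new constants EXPLICIT.**  Data: L = Q′(U)G′²(U)Q′\*(U) with inverse Cinv (`Linv`, two-sided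
on the finite-dimensional space; `hL`), L′ = Q′(U′U)G′²(U′U)Q′\*(U′U) = L + C′(A) ((3.65), `h365`).  Hypotheses, all of
the printed shape: `h348` = Theorem 3.2 (3.48) for the kernel of Cinv; `h366` = (3.66) for the kernel of C′(A) with its
O(1) =: κ; Lemma 2.1 of [4]: the scale transfer of the p. 398 remark at exponent α for the weight (L^jη)^{−4} with
constant C (= L⁴ under L⁴e^{−αδ₀RM} ≦ 1, `B9Ineq347.scaleTransfer_of_260`) and (2.61) at the two exponent/rate pairs
(½ + α, δ₀), (α′, (½ − α)δ₀); the properties of the distance d of [4] (2.46) (triangle inequality, symmetry,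
d(y,y) = 0, d ≧ 0) and L^jη > 0; and the EXPLICIT smallness **α₁ ≦ a₁ := (2κB₀Cc₁(δ₀, ½+α)·c₁((½−α)δ₀, α′))⁻¹**.
Conclusion: L′ has a two-sided inverse T whose kernel satisfies (3.48) with the constants
**B₁′ = 2B₀c₁((½−α)δ₀, α′)**, **δ₁′ = (1−α′)(½−α)δ₀**: |T(y, y′)| ≦ B₁′(L^jη)^{−4}(L^{j′}η)^{−d}e^{−δ₁′d(y,y′)} — the
(B₁′, δ₁′) of `B9.SectBStepPrinted`'s conclusion for this operator, a₁ depending on d, L only (through κ, B₀, δ₀, C,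
c₁ = 12c₀^d). [cite: Balaban1985BackgroundPropagators, Thm 3.2 (3.48) p.398 + (3.65)–(3.67) p.403 + Thm 3.4 p.400] -/
theorem inverse_satisfies_thm32 (d : ℕ) (δ₀ α α' κ B₀ C α₁ : ℝ)
    (hδ₀ : 0 < δ₀) (hα0 : 0 < α) (hα : α < 1 / 2) (hα' : α' < 1)
    (hκ : 0 < κ) (hB₀ : 0 < B₀) (hC : 0 < C) (hα₁ : 0 ≤ α₁)
    (hc₁ : 0 < B6.c1 d δ₀ (1 / 2 + α)) (hc₁' : 0 < B6.c1 d ((1 / 2 - α) * δ₀) α')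
    (htri : B6RandomWalk.Triangle254 (B9Thm34Ext.toB6 g R H)) (hsymm : ∀ a b : g.Site, g.dist a b = g.dist b a)
    (hrefl : ∀ y : g.Site, g.dist y y = 0) (hdnn : ∀ a b : g.Site, 0 ≤ g.dist a b)
    (hlen : ∀ y : g.Site, 0 < g.len y)
    (hST : B9Ineq347.ScaleTransfer g δ₀ α C (fun y => g.len y ^ (-(4 : ℝ))))
    (h261 : B6RandomWalk.Ineq261 d (B9Thm34Ext.toB6 g R H) δ₀ (1 / 2 + α))
    (h261' : B6RandomWalk.Ineq261 d (B9Thm34Ext.toB6 g R H) ((1 / 2 - α) * δ₀) α')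
    (ha₁ : α₁ ≤ (2 * (κ * B₀ * C * B6.c1 d δ₀ (1 / 2 + α)) * B6.c1 d ((1 / 2 - α) * δ₀) α')⁻¹)
    {L L' Linv Cp : Module.End ℝ (g.Site → ℝ)}
    (hL : L * Linv = 1)
    (h348 : ∀ y y' : g.Site, |ker (vol g d) Linv y y'| ≤
      B₀ * g.len y ^ (-(4 : ℝ)) * g.len y' ^ (-(d : ℝ)) * Real.exp (-(δ₀ * g.dist y y')))
    (h365 : L' = L + Cp)
    (h366 : ∀ y y' : g.Site, |ker (vol g d) Cp y y'| ≤
      κ * α₁ * g.len y ^ (4 : ℝ) * g.len y' ^ (-(d : ℝ)) * Real.exp (-(δ₀ / 2 * g.dist y y'))) :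
    ∃ T : Module.End ℝ (g.Site → ℝ), T * L' = 1 ∧ L' * T = 1 ∧
      ∀ y y' : g.Site, |ker (vol g d) T y y'| ≤
        2 * B₀ * B6.c1 d ((1 / 2 - α) * δ₀) α' * g.len y ^ (-(4 : ℝ)) * g.len y' ^ (-(d : ℝ)) *
          Real.exp (-((1 - α') * ((1 / 2 - α) * δ₀) * g.dist y y')) := by
  -- abbreviations
  set P : g.Site → ℝ := fun y => g.len y ^ (-(4 : ℝ)) with hPdef
  set r : ℝ := (1 / 2 - α) * δ₀ with hrdef
  set c : ℝ := B6.c1 d δ₀ (1 / 2 + α) with hcdef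
  set c' : ℝ := B6.c1 d r α' with hc'def
  set θ : ℝ := κ * α₁ * B₀ * C * c with hθdef
  have hP : ∀ y, 0 < P y := fun y => Real.rpow_pos_of_pos (hlen y) _
  have hPinv : ∀ y, (P y)⁻¹ = g.len y ^ (4 : ℝ) := fun y => by
    rw [hPdef]
    simp only
    rw [Real.rpow_neg (hlen y).le, inv_inv]
  have hvol := vol_pos d hlen
  have hr : 0 ≤ r := mul_nonneg (by linarith) hδ₀.le
  have hrδ : r ≤ δ₀ := by
    have : r = δ₀ - (1 / 2 + α) * δ₀ := by rw [hrdef]; ring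
    nlinarith
  have hθ : 0 ≤ θ := by positivity
  -- the smallness θ c' ≤ 1/2 from α₁ ≤ a₁
  have hprod : 0 < 2 * (κ * B₀ * C * c) * c' := by positivity
  have hθc : θ * c' ≤ 1 / 2 := by
    have h1 : α₁ * (2 * (κ * B₀ * C * c) * c') ≤ 1 := by
      have := mul_le_mul_of_nonneg_right ha₁ hprod.le
      rwa [inv_mul_cancel₀ hprod.ne'] at this
    have : θ * c' = α₁ * (2 * (κ * B₀ * C * c) * c') / 2 := by rw [hθdef]; ring
    rw [this]
    linarith
  have hsmall : θ * c' < 1 := by linarith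
  -- (3.48) and (3.66) in pairing (entry) form
  have h348e : B6RandomWalk.HasMajorant (g := B9Thm34Ext.toB6 g R H) (fun x : g.Site => x) Linv
      (fun a b => B₀ * P a * Real.exp (-(δ₀ * g.dist a b))) := by
    refine (hasMajorant_id_iff _ _).mpr fun y y' => (ker_le_iff (vol g d) (hvol y') Linv y _).mp ?_
    refine (h348 y y').trans (le_of_eq ?_)
    rw [vol_inv d hlen y']
    simp only [hPdef]
    ring
  have h366e : B6RandomWalk.HasMajorant (g := B9Thm34Ext.toB6 g R H) (fun x : g.Site => x) Cp
      (fun a b => κ * α₁ * (P a)⁻¹ * Real.exp (-(δ₀ / 2 * g.dist a b))) := by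
    refine (hasMajorant_id_iff _ _).mpr fun y y' => (ker_le_iff (vol g d) (hvol y') Cp y _).mp ?_
    refine (h366 y y').trans (le_of_eq ?_)
    rw [vol_inv d hlen y', hPinv y]
    ring
  -- (3.67): the majorant of E = C′(A)·Cinv
  have h367 : B6RandomWalk.HasMajorant (g := B9Thm34Ext.toB6 g R H) (fun x : g.Site => x) (Cp * Linv)
      (fun a b => θ * Real.exp (-(r * g.dist a b))) := by
    have h := ineq367_of_366_348 (R := R) (H := H) d δ₀ α κ B₀ C α₁ P hκ.le hα₁ hB₀.le hC.le hP hα.le hδ₀.le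
      htri hsymm hST h261 h366e h348e
    refine B6RandomWalk.hasMajorant_mono (g := B9Thm34Ext.toB6 g R H) _ h fun a b => le_of_eq ?_
    simp only [hθdef, hcdef, hrdef]
  -- invertibility of L′ and the fixed-point equation of its inverse
  have hLinv : Linv * L = 1 := mul_eq_one_symm hL
  have hunit : IsUnit L' :=
    isUnit_ext (R := R) (H := H) d r α' θ hθ hα'.le hr hdnn h261' hsmall hL hLinv h365 h367
  obtain ⟨u, hu⟩ := hunit
  refine ⟨↑u⁻¹, by rw [← hu]; exact u.inv_mul, by rw [← hu]; exact u.mul_inv, ?_⟩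
  have hT : (↑u⁻¹ : Module.End ℝ (g.Site → ℝ)) * L' = 1 := by rw [← hu]; exact u.inv_mul
  have hfix := fixedPoint_of_inverse hL h365 hT
  -- (3.48) for Cinv with the rate weakened to r
  have h348r : B6RandomWalk.HasMajorant (g := B9Thm34Ext.toB6 g R H) (fun x : g.Site => x) Linv
      (fun a b => B₀ * P a * Real.exp (-(r * g.dist a b))) := by
    refine B6RandomWalk.hasMajorant_mono (g := B9Thm34Ext.toB6 g R H) _ h348e fun a b => ?_
    refine mul_le_mul_of_nonneg_left (Real.exp_le_exp.mpr ?_) (mul_nonneg hB₀.le (hP a).le)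
    have := mul_le_mul_of_nonneg_right hrδ (hdnn a b)
    linarith
  -- the Neumann series bound
  have hmaj := inv_majorant_of_367 (R := R) (H := H) d r α' θ B₀ P hB₀.le (fun y => (hP y).le) hθ hr hα'.le htri
    hrefl hdnn h261' hsmall h348r h367 hfix
  have hent := (hasMajorant_id_iff _ _).mp hmaj
  -- back to the printed kernel notation, with (1 − θc')⁻¹ ≦ 2
  intro y y'
  have hinv : (1 - θ * c')⁻¹ ≤ 2 := by
    rw [inv_le_comm₀ (by linarith) (by norm_num : (0 : ℝ) < 2)]
    linarith
  have hconst : B₀ * c' * (1 - θ * c')⁻¹ ≤ 2 * B₀ * c' := by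
    calc B₀ * c' * (1 - θ * c')⁻¹ ≤ B₀ * c' * 2 :=
          mul_le_mul_of_nonneg_left hinv (mul_nonneg hB₀.le hc₁'.le)
      _ = 2 * B₀ * c' := by ring
  have hb : |entry (↑u⁻¹ : Module.End ℝ (g.Site → ℝ)) y y'| ≤
      2 * B₀ * c' * P y * Real.exp (-((1 - α') * r * g.dist y y')) := by
    refine (hent y y').trans ?_
    have hrest : 0 ≤ P y * Real.exp (-((1 - α') * r * g.dist y y')) :=
      mul_nonneg (hP y).le (Real.exp_nonneg _)
    calc B₀ * c' * (1 - θ * c')⁻¹ * P y * Real.exp (-((1 - α') * r * g.dist y y'))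
        = B₀ * c' * (1 - θ * c')⁻¹ * (P y * Real.exp (-((1 - α') * r * g.dist y y'))) := by ring
      _ ≤ 2 * B₀ * c' * (P y * Real.exp (-((1 - α') * r * g.dist y y'))) :=
          mul_le_mul_of_nonneg_right hconst hrest
      _ = _ := by ring
  have hk := (ker_le_iff (vol g d) (hvol y') (↑u⁻¹ : Module.End ℝ (g.Site → ℝ)) y _).mpr hb
  refine hk.trans (le_of_eq ?_)
  rw [vol_inv d hlen y', hPdef]
  simp only
  ring

end Majorants

end Literature.MathematicalPhysics.QuantumFieldTheory.Balaban1983to89.B9Thm34Inv
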